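import Mathlib
import Summits.NavierStokesRegularity.NavierStokesRegularity.Theorems.FilamentSkeletonRssDefectColumnGateRadialBlockPrelim
import Summits.NavierStokesRegularity.NavierStokesRegularity.Theorems.FilamentSkeletonRssDefectColumnGateQuadrupoleBlockFlux

/-!
# Route `FilamentSkeletonRss` · crux `TransverseReduction1AG` (stmt-NavierStokesRegularity-27853) · line `defect_column_gate_1AG` —
# the m = 2 (QUADRUPOLE) radial block of the localised sectional waist gate `WaistColumnGateLoc1A` (stub S2a-loc), symmetric column,
# `Rc = 0`: a-priori bound in the sectional sup-weight with NO loss in the localisation radius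

Helper file (`--supports stmt-NavierStokesRegularity-27853 --as helper`; seat ns-filament-s2aloc-p1 g0; briefs v5 brick B2 «|m| ≥ 1 radial blocks of
the SYMMETRIC column in sup-weights», here its m = 2 instance at zero circulation).  Third of three files (`…QuadrupoleBlockPrelim`,
`…QuadrupoleBlockFlux`, this).  Companion of the LEAD's m = 0 block `Theorems/…RadialBlock.lean` (`radialBlock_apriori`, p661788).

THE BLOCK.  Symmetric sectional strain `B_⊥ = −(γ/2)·Id`, no column (`Rc = 0`), axially constant horizontal perturbation with azimuthal order 2:
`ω = ω₂(r)e^{2iθ}`.  In `u = r²` with `ω₂ = w(u) = u·v(u)` (an m = 2 coefficient of a smooth field is `r²`·smooth) the sectional operator of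
`colForceVort_eq` is `L₂w = −(4u w′ + γu w)′ + 4w/u`, i.e. with `Φ(u) := 4u v + 4u² v₁ + γu² v` (`v₁ = v′`): `f = 4v − Φ′`.
HYPOTHESES (as in the m = 0 block): `v, v₁` continuous on `[0,∞)`, `v′ = v₁` and `Φ′ = 4v − f` on `(0,∞)`, datum `(1+u)²|f| ≤ M`, support `v = v₁ = 0`
on `[U, ∞)` with `U ≥ 1` (`U = R²`).  CONCLUSION (`quadrupoleBlock_apriori`): `(1+u)²·u|v(u)| = (1+u)²|w(u)| ≤ C(γ)·M` for all `u ≥ 0`, with `C(γ)`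
depending on `γ` only — uniformly in `U`.  (Kit j317137 of this seat: the true constant is ≈ 1.3/γ; the constant produced here is far from sharp.)

MECHANISM: `L₂` has the closed-form homogeneous pair `1/u` (the harmonic `1/z̄²`) and `g(u)/u` (Prelim); with `E = e^{γu/4}`, `K := 4E(2v + u v₁)`,
`H := 4u²v − g·K`, `J := g(U)·K + H`: `K′ = −E f/u`, `H′ = g E f/u`, `J′ = −(g(U) − g)E f/u` (Flux), `K(U) = H(U) = J(U) = 0`, `H(0) = 0`, so
`4u²v = (1 − g/g(U))·H + (g/g(U))·J` with `H` bounded from `u = 0` (Flux) and `J` from `u = U` (§1: the tail identity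
`(g(U) − g(u))e^{γu/4} ≤ (4/γ)(u + 4/γ)` removes the `e^{γU/4}` of the support condition, as zero mass did for m = 0).  The datum is never integrated.
HONEST FRAMING: one block of one linear MODEL operator of a hypothetical blow-up route (MODEL rung, negative side); `WaistColumnGateLoc1A` and
`TransverseReduction1AG` are neither proved nor refuted here; nothing in this file bears on Navier–Stokes regularity.
-/

set_option linter.dupNamespace false

noncomputable section

namespace Summit.NavierStokesRegularity.NavierStokesRegularity.Theorems.DefectColumnGate

open scoped Topology
open Set Filter MeasureTheory intervalIntegral

/-! ## 1. The outer flux `J = g(U)·K + H`, controlled from `u = U` -/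

set_option maxHeartbeats 800000 in
/-- **Bound of `J`.**  Under the block hypotheses with support `v = v₁ = 0` on `[U,∞)`: for `0 < u ≤ U`,
`|J(u)| ≤ (4M/γ)·(1/(1+u) + (4/γ)/(u(1+u)))`, where `J = g(U)·4e^{γu/4}(2v + u v₁) + (4u²v − g(u)·4e^{γu/4}(2v + u v₁))`. -/
theorem quadrupoleBlock_J_bound {γ : ℝ} (hγ : 0 < γ) {U M : ℝ} {v v₁ f : ℝ → ℝ} (hU : 1 ≤ U)
    (hv : ContinuousOn v (Ici 0)) (hv₁ : ContinuousOn v₁ (Ici 0))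
    (hder : ∀ u, 0 < u → HasDerivAt v (v₁ u) u)
    (hΦ : ∀ u, 0 < u → HasDerivAt (fun s => 4 * s * v s + 4 * s ^ 2 * v₁ s + γ * s ^ 2 * v s) (4 * v u - f u) u)
    (hf : ∀ u, 0 < u → (1 + u) ^ 2 * |f u| ≤ M)
    (hsupp : ∀ u, U ≤ u → v u = 0) (hsupp₁ : ∀ u, U ≤ u → v₁ u = 0) :
    ∀ u, 0 < u → u ≤ U →
      |(16 / γ ^ 2 * (1 - Real.exp (-(γ * U / 4)) * (1 + γ * U / 4))) * (4 * Real.exp (γ * u / 4) * (2 * v u + u * v₁ u))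
        + (4 * u ^ 2 * v u
          - (16 / γ ^ 2 * (1 - Real.exp (-(γ * u / 4)) * (1 + γ * u / 4))) * (4 * Real.exp (γ * u / 4) * (2 * v u + u * v₁ u)))|
      ≤ 4 * M / γ * (1 / (1 + u) + 4 / γ * (1 / (u * (1 + u)))) := by
  set g : ℝ → ℝ := fun t => 16 / γ ^ 2 * (1 - Real.exp (-(γ * t / 4)) * (1 + γ * t / 4)) with hgdef
  set E : ℝ → ℝ := fun t => Real.exp (γ * t / 4) with hEdef
  set K : ℝ → ℝ := fun t => 4 * E t * (2 * v t + t * v₁ t) with hKdef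
  set H : ℝ → ℝ := fun t => 4 * t ^ 2 * v t - g t * K t with hHdef
  set J : ℝ → ℝ := fun t => g U * K t + H t with hJdef
  show ∀ u, 0 < u → u ≤ U → |J u| ≤ 4 * M / γ * (1 / (1 + u) + 4 / γ * (1 / (u * (1 + u))))
  have hU0 : 0 ≤ U := zero_le_one.trans hU
  have hM : 0 ≤ M := le_trans (by positivity) (hf 1 one_pos)
  have hfle : ∀ s, 0 < s → |f s| ≤ M / (1 + s) ^ 2 := fun s hs => by rw [le_div_iff₀ (by positivity)]; linarith [hf s hs]
  have hEpos : ∀ s, 0 < E s := fun s => Real.exp_pos _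
  have hEinv : ∀ s, Real.exp (-(γ * s / 4)) * E s = 1 := fun s => by
    simp only [hEdef]; rw [← Real.exp_add]; simp
  have hK : ∀ s, 0 < s → HasDerivAt K (-(E s * f s / s)) s := fun s hs =>
    quadrupoleBlock_hasDerivAt_K hder hΦ hs
  have hH : ∀ s, 0 < s → HasDerivAt H (g s * E s * f s / s) s := fun s hs =>
    quadrupoleBlock_hasDerivAt_H hγ hder hΦ hs
  have hJ : ∀ s, 0 < s → HasDerivAt J (-((g U - g s) * E s * f s / s)) s := by
    intro s hs
    refine (((hK s hs).const_mul (g U)).add (hH s hs)).congr_deriv ?_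
    have hs0 : s ≠ 0 := hs.ne'
    field_simp
    ring
  have hKU : K U = 0 := by simp [hKdef, hsupp U le_rfl, hsupp₁ U le_rfl]
  have hHU : H U = 0 := by simp [hHdef, hKU, hsupp U le_rfl]
  have hJU : J U = 0 := by simp [hJdef, hKU, hHU]
  have hEc : Continuous E := by simp only [hEdef]; fun_prop
  have hgc : Continuous g := by simp only [hgdef]; fun_prop
  have hKc : ContinuousOn K (Ici 0) := by
    simp only [hKdef]
    exact (continuousOn_const.mul hEc.continuousOn).mul
      ((continuousOn_const.mul hv).add (continuousOn_id.mul hv₁))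
  have hHc : ContinuousOn H (Ici 0) := by
    simp only [hHdef]
    exact ((continuousOn_const.mul (continuousOn_pow 2)).mul hv).sub (hgc.continuousOn.mul hKc)
  have hJc : ContinuousOn J (Ici 0) := by
    simp only [hJdef]
    exact (continuousOn_const.mul hKc).add hHc
  have hg_mono : ∀ a b, 0 ≤ a → a ≤ b → g a ≤ g b := fun a b ha hab => quadG_mono hγ ha hab
  have hg_sub : ∀ a, g U - g a ≤ 4 / γ * (a + 4 / γ) * Real.exp (-(γ * a / 4)) := fun a => quadG_sub_le hγ hU0
  clear_value g E K H J
  intro u hu huU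
  have hAtd : ∀ x, 0 < x → HasDerivAt
      (fun t : ℝ => 4 * M / γ * (4 / γ * (Real.log (t / (1 + t)) + 1 / (1 + t)) - 1 / (1 + t)))
      (4 * M / γ * (4 / γ * (1 / (x * (1 + x) ^ 2)) - ((0:ℝ) * (1 + x) - 1 * 1) / (1 + x) ^ 2)) x := by
    intro x hx
    have h1x : (1 + x) ≠ 0 := by linarith
    exact (((kernel_log_hasDerivAt hx).const_mul (4 / γ)).sub
      ((hasDerivAt_const x (1:ℝ)).div ((hasDerivAt_id' x).const_add 1) h1x)).const_mul _
  have hAtc : ContinuousOn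
      (fun t : ℝ => 4 * M / γ * (4 / γ * (Real.log (t / (1 + t)) + 1 / (1 + t)) - 1 / (1 + t))) (Icc u U) := by
    have hpos : ∀ x ∈ Icc u U, 0 < x := fun x hx => hu.trans_le hx.1
    apply ContinuousOn.mul continuousOn_const
    apply ContinuousOn.sub
    · apply ContinuousOn.mul continuousOn_const
      apply ContinuousOn.add
      · apply ContinuousOn.log
        · apply ContinuousOn.div continuousOn_id (by fun_prop)
          intro x hx; have := hpos x hx; linarith
        · intro x hx; have := hpos x hx; positivity
      · apply ContinuousOn.div continuousOn_const (by fun_prop)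
        intro x hx; have := hpos x hx; linarith
    · apply ContinuousOn.div continuousOn_const (by fun_prop)
      intro x hx; have := hpos x hx; linarith
  have hcmp := abs_sub_le_of_deriv_abs_le (h := J)
    (A := fun t : ℝ => 4 * M / γ * (4 / γ * (Real.log (t / (1 + t)) + 1 / (1 + t)) - 1 / (1 + t))) huU
    (hJc.mono (fun x hx => (hu.le.trans hx.1 : 0 ≤ x))) hAtc
    (fun x hx => hJ x (hu.trans hx.1)) (fun x hx => hAtd x (hu.trans hx.1))
    (fun x hx => by
      have hx0 : 0 < x := hu.trans hx.1
      have h1x : 0 < 1 + x := by linarith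
      have hxU : x ≤ U := hx.2.le
      rw [abs_neg, abs_div, abs_mul, abs_mul, abs_of_nonneg (sub_nonneg.mpr (hg_mono x U hx0.le hxU)),
        abs_of_pos (hEpos x), abs_of_pos hx0]
      have htail : (g U - g x) * E x ≤ 4 / γ * (x + 4 / γ) := by
        have h2 := mul_le_mul_of_nonneg_right (hg_sub x) (hEpos x).le
        calc (g U - g x) * E x ≤ 4 / γ * (x + 4 / γ) * Real.exp (-(γ * x / 4)) * E x := h2
          _ = 4 / γ * (x + 4 / γ) * (Real.exp (-(γ * x / 4)) * E x) := by ring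
          _ = 4 / γ * (x + 4 / γ) := by rw [hEinv x, mul_one]
      calc (g U - g x) * E x * |f x| / x ≤ (4 / γ * (x + 4 / γ)) * (M / (1 + x) ^ 2) / x := by
            gcongr
            exact hfle x hx0
        _ = 4 * M / γ * (4 / γ * (1 / (x * (1 + x) ^ 2)) - ((0:ℝ) * (1 + x) - 1 * 1) / (1 + x) ^ 2) := by
            field_simp
            ring)
  rw [hJU, zero_sub, abs_neg] at hcmp
  have hφU : Real.log (U / (1 + U)) + 1 / (1 + U) ≤ 0 := kernel_log_nonpos (hu.trans_le huU)
  have hφu : -(Real.log (u / (1 + u)) + 1 / (1 + u)) ≤ 1 / (u * (1 + u)) := by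
    have h := neg_log_div_le hu
    have : 1 / u - 1 / (1 + u) = 1 / (u * (1 + u)) := by field_simp; ring
    linarith
  have h1U : 0 ≤ 1 / (1 + U) := by positivity
  have h4γ : 0 ≤ 4 / γ := by positivity
  have hMγ : 0 ≤ 4 * M / γ := by positivity
  have e1 := mul_le_mul_of_nonneg_left hφU h4γ
  have e2 := mul_le_mul_of_nonneg_left hφu h4γ
  have hbr : (4 / γ * (Real.log (U / (1 + U)) + 1 / (1 + U)) - 1 / (1 + U))
      - (4 / γ * (Real.log (u / (1 + u)) + 1 / (1 + u)) - 1 / (1 + u))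
      ≤ 1 / (1 + u) + 4 / γ * (1 / (u * (1 + u))) := by
    rw [mul_neg] at e2
    linarith only [e1, e2, h1U]
  have := mul_le_mul_of_nonneg_left hbr hMγ
  rw [mul_sub] at this
  exact hcmp.trans this

/-! ## 2. The a-priori estimate for the m = 2 block -/

set_option maxHeartbeats 1600000 in
/-- **The m = 2 radial block of S2a-loc (symmetric column, `Rc = 0`), no loss in the localisation radius.**  See the module docstring for the
dictionary.  Data in `u = r²`: `v` (= `ω₂/r²`) and `v₁` continuous on `[0,∞)`, `v′ = v₁` on `(0,∞)`; the block `(4u v + 4u² v₁ + γu² v)′ = 4v − f` on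
`(0,∞)` with `(1+u)²|f| ≤ M`; support `v = v₁ = 0` on `[U,∞)`, `U ≥ 1`.  Conclusion: `(1+u)²·(u·|v u|) ≤ C·M` on `[0,∞)` with `C = C(γ)` (explicit in
the proof, polynomial in `1/γ` times `e^{γ/4 + 4}`; far from the numerically observed ≈ 1.3/γ). -/
theorem quadrupoleBlock_apriori {γ : ℝ} (hγ : 0 < γ) :
    ∃ C : ℝ, 0 < C ∧ ∀ (U M : ℝ) (v v₁ f : ℝ → ℝ), 1 ≤ U →
      ContinuousOn v (Ici 0) → ContinuousOn v₁ (Ici 0) →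
      (∀ u, 0 < u → HasDerivAt v (v₁ u) u) →
      (∀ u, 0 < u → HasDerivAt (fun s => 4 * s * v s + 4 * s ^ 2 * v₁ s + γ * s ^ 2 * v s) (4 * v u - f u) u) →
      (∀ u, 0 < u → (1 + u) ^ 2 * |f u| ≤ M) →
      (∀ u, U ≤ u → v u = 0) → (∀ u, U ≤ u → v₁ u = 0) →
      ∀ u, 0 ≤ u → (1 + u) ^ 2 * (u * |v u|) ≤ C * M := by
  set G₀ : ℝ := 2 * (1 + 16 / γ ^ 2) with hG₀
  set s₁ : ℝ := 1 + 16 / γ with hs₁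
  set T₁ : ℝ := (1 + s₁) ^ 2 * (s₁ + 4 / γ) * G₀ / γ with hT₁
  set T₂ : ℝ := (1 + 4 / γ) / γ * (4 * G₀ / γ) * (Real.exp (γ * s₁ / 4) * (1 + 4 / (γ / 4) ^ 2) + 4) with hT₂
  set T₃ : ℝ := 2 / γ * (1 + 4 / γ) * (1 + 16 / γ ^ 2) with hT₃
  set gl : ℝ := Real.exp (-(γ / 4)) / 2 with hgl
  have hglpos : 0 < gl := by positivity
  have hG₀pos : 0 < G₀ := by positivity
  have hs₁ge : 1 ≤ s₁ := le_add_of_nonneg_right (by positivity)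
  have hT₁pos : 0 < T₁ := by positivity
  have hT₂pos : 0 < T₂ := by positivity
  have hT₃pos : 0 < T₃ := by positivity
  refine ⟨(T₁ + T₂ + T₃) / gl + 1, by positivity, ?_⟩
  intro U M v v₁ f hU hv hv₁ hder hΦ hf hsupp hsupp₁ u hu
  have hM : 0 ≤ M := le_trans (by positivity) (hf 1 one_pos)
  set g : ℝ → ℝ := fun t => 16 / γ ^ 2 * (1 - Real.exp (-(γ * t / 4)) * (1 + γ * t / 4)) with hgdef
  set E : ℝ → ℝ := fun t => Real.exp (γ * t / 4) with hEdef
  set K : ℝ → ℝ := fun t => 4 * E t * (2 * v t + t * v₁ t) with hKdef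
  set H : ℝ → ℝ := fun t => 4 * t ^ 2 * v t - g t * K t with hHdef
  set J : ℝ → ℝ := fun t => g U * K t + H t with hJdef
  obtain ⟨hHb₁, hHb₂⟩ := quadrupoleBlock_H_bounds hγ hv hv₁ hder hΦ hf
  have hHbound₁' : ∀ u, 0 ≤ u → |H u| ≤ G₀ * M * u * E u := fun u hu => hHb₁ u hu
  have hHbound₂ : ∀ u, s₁ ≤ u → |H u| ≤ 4 * G₀ * M / γ * E s₁ + 16 * G₀ * M / γ * (E u / (1 + u) ^ 2) :=
    fun u hu => hHb₂ u hu
  have hJbound : ∀ u, 0 < u → u ≤ U → |J u| ≤ 4 * M / γ * (1 / (1 + u) + 4 / γ * (1 / (u * (1 + u)))) :=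
    fun u hu huU => quadrupoleBlock_J_bound hγ hU hv hv₁ hder hΦ hf hsupp hsupp₁ u hu huU
  have hEs₁ : E s₁ = Real.exp (γ * s₁ / 4) := rfl
  have hEpos : ∀ s, 0 < E s := fun s => Real.exp_pos _
  have hEinv : ∀ s, Real.exp (-(γ * s / 4)) * E s = 1 := fun s => by simp only [hEdef]; rw [← Real.exp_add]; simp
  have hU0 : 0 ≤ U := zero_le_one.trans hU
  have hg_nonneg : ∀ s, 0 ≤ s → 0 ≤ g s := fun s hs => quadG_nonneg hγ hs
  have hgU : gl ≤ g U := quadG_ge_of_one_le hγ hU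
  have hgUpos : 0 < g U := hglpos.trans_le hgU
  have hg_mono : ∀ a b, 0 ≤ a → a ≤ b → g a ≤ g b := fun a b ha hab => quadG_mono hγ ha hab
  have hg_sub : ∀ a, g U - g a ≤ 4 / γ * (a + 4 / γ) * Real.exp (-(γ * a / 4)) := fun a => quadG_sub_le hγ hU0
  have hg_sq : ∀ a, 0 ≤ a → g a ≤ a ^ 2 := fun a ha => quadG_le_sq hγ ha
  have hg_sup : ∀ a, 0 ≤ a → g a ≤ 16 / γ ^ 2 := fun a ha => quadG_le_sup hγ ha
  have hHu : H u = 4 * u ^ 2 * v u - g u * K u := by rw [hHdef]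
  have hJu : J u = g U * K u + H u := by rw [hJdef]
  clear_value g E K H J
  -- ASSEMBLY
  rcases eq_or_lt_of_le hu with h0 | hupos
  · subst h0; simp; positivity
  rcases le_or_gt u U with huU | hUu
  swap; · rw [hsupp u hUu.le]; simp; positivity
  have hu0 : u ≠ 0 := hupos.ne'
  have h1u : 0 < 1 + u := by linarith
  have h4γ : (0:ℝ) ≤ 4 / γ := by positivity
  have h16 : (0:ℝ) ≤ 16 / γ ^ 2 := by positivity
  -- the representation  4u² v = (1 − g/gU) H + (g/gU) J   (J = gU·K + H,  H = 4u²v − g K)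
  have hrep : 4 * u ^ 2 * v u = (1 - g u / g U) * H u + (g u / g U) * J u := by
    rw [hJu, hHu]
    field_simp
    ring
  have hgu_le : g u ≤ g U := hg_mono u U hupos.le huU
  have hgu_nn : 0 ≤ g u := hg_nonneg u hupos.le
  have hcoef₁ : 0 ≤ 1 - g u / g U := by rw [sub_nonneg, div_le_one hgUpos]; exact hgu_le
  have hcoef₁' : 1 - g u / g U ≤ 4 / γ * (u + 4 / γ) * Real.exp (-(γ * u / 4)) / g U := by
    rw [show 1 - g u / g U = (g U - g u) / g U by field_simp]
    exact div_le_div_of_nonneg_right (hg_sub u) hgUpos.le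
  have hcoef₂ : 0 ≤ g u / g U := div_nonneg hgu_nn hgUpos.le
  have hgU0 : g U ≠ 0 := hgUpos.ne'
  have habs : 4 * u ^ 2 * |v u| ≤ (1 - g u / g U) * |H u| + (g u / g U) * |J u| := by
    have : |4 * u ^ 2 * v u| = 4 * u ^ 2 * |v u| := by rw [abs_mul, abs_of_pos (by positivity)]
    rw [← this, hrep]
    calc |(1 - g u / g U) * H u + g u / g U * J u| ≤ |(1 - g u / g U) * H u| + |g u / g U * J u| := abs_add_le _ _
      _ = (1 - g u / g U) * |H u| + (g u / g U) * |J u| := by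
          rw [abs_mul, abs_mul, abs_of_nonneg hcoef₁, abs_of_nonneg hcoef₂]
  have hsq_exp : (1 + u) ^ 2 * Real.exp (-(γ * u / 4)) ≤ 1 + 4 / (γ / 4) ^ 2 := by
    have := radialBlock_sq_mul_exp_neg_le (c := γ / 4) (u := u) (by positivity) hupos.le
    rwa [show γ / 4 * u = γ * u / 4 by ring] at this
  -- TermA:  (1+u)² (1 − g/gU)|H u| ≤ 4u (T₁+T₂) M / gU
  have hTermA : (1 + u) ^ 2 * ((1 - g u / g U) * |H u|) ≤ 4 * u * ((T₁ + T₂) * M / g U) := by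
    -- reduce to the numerator N := (1+u)²·D·|H u| with D = (4/γ)(u+4/γ)e^{−γu/4}
    have hstep : (1 + u) ^ 2 * ((1 - g u / g U) * |H u|)
        ≤ ((1 + u) ^ 2 * (4 / γ * (u + 4 / γ) * Real.exp (-(γ * u / 4))) * |H u|) / g U := by
      have := mul_le_mul_of_nonneg_right hcoef₁' (abs_nonneg (H u))
      have := mul_le_mul_of_nonneg_left this (sq_nonneg (1 + u))
      calc (1 + u) ^ 2 * ((1 - g u / g U) * |H u|)
          ≤ (1 + u) ^ 2 * (4 / γ * (u + 4 / γ) * Real.exp (-(γ * u / 4)) / g U * |H u|) := this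
        _ = ((1 + u) ^ 2 * (4 / γ * (u + 4 / γ) * Real.exp (-(γ * u / 4))) * |H u|) / g U := by ring
    refine hstep.trans ?_
    rw [show 4 * u * ((T₁ + T₂) * M / g U) = (4 * u * (T₁ + T₂) * M) / g U by ring]
    apply div_le_div_of_nonneg_right _ hgUpos.le
    rcases le_or_gt u s₁ with hus | hsu
    · -- u ≤ s₁
      have hH1 := hHbound₁' u hupos.le
      have hT₁ge : (1 + u) ^ 2 * (u + 4 / γ) * G₀ / γ ≤ T₁ := by
        rw [hT₁]
        have ha : (1 + u) ^ 2 ≤ (1 + s₁) ^ 2 := by gcongr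
        have hb : u + 4 / γ ≤ s₁ + 4 / γ := by linarith
        have := mul_le_mul ha hb (by positivity) (by positivity)
        have := mul_le_mul_of_nonneg_right this (show 0 ≤ G₀ / γ by positivity)
        calc (1 + u) ^ 2 * (u + 4 / γ) * G₀ / γ = (1 + u) ^ 2 * (u + 4 / γ) * (G₀ / γ) := by ring
          _ ≤ (1 + s₁) ^ 2 * (s₁ + 4 / γ) * (G₀ / γ) := this
          _ = (1 + s₁) ^ 2 * (s₁ + 4 / γ) * G₀ / γ := by ring
      calc (1 + u) ^ 2 * (4 / γ * (u + 4 / γ) * Real.exp (-(γ * u / 4))) * |H u|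
          ≤ (1 + u) ^ 2 * (4 / γ * (u + 4 / γ) * Real.exp (-(γ * u / 4))) * (G₀ * M * u * E u) := by
            gcongr
        _ = 4 * u * ((1 + u) ^ 2 * (u + 4 / γ) * G₀ / γ) * M * (Real.exp (-(γ * u / 4)) * E u) := by ring
        _ = 4 * u * ((1 + u) ^ 2 * (u + 4 / γ) * G₀ / γ) * M := by rw [hEinv u, mul_one]
        _ ≤ 4 * u * T₁ * M := by
            have := mul_le_mul_of_nonneg_left hT₁ge (show 0 ≤ 4 * u by positivity)
            have := mul_le_mul_of_nonneg_right this hM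
            linarith only [this]
        _ ≤ 4 * u * (T₁ + T₂) * M := by
            have : 4 * u * T₁ ≤ 4 * u * (T₁ + T₂) := by nlinarith only [hT₂pos, hupos]
            exact mul_le_mul_of_nonneg_right this hM
    · -- u ≥ s₁ (≥ 1)
      have hus : s₁ ≤ u := hsu.le
      have hu1 : 1 ≤ u := hs₁ge.trans hus
      have hH2 := hHbound₂ u hus
      have hratio : (u + 4 / γ) ≤ (1 + 4 / γ) * u := by
        have := le_mul_of_one_le_right h4γ hu1
        linarith only [this]
      set P : ℝ := 4 * G₀ * M / γ * E s₁ with hP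
      set Q : ℝ := 16 * G₀ * M / γ * (E u / (1 + u) ^ 2) with hQ
      have hPnn : 0 ≤ P := by have := hEpos s₁; positivity
      have hDnn : 0 ≤ 4 / γ * (u + 4 / γ) * Real.exp (-(γ * u / 4)) := by positivity
      -- F1: D·(1+u)² ≤ (4/γ)(u+4/γ)(1 + 4/(γ/4)²)
      have F1 : (1 + u) ^ 2 * (4 / γ * (u + 4 / γ) * Real.exp (-(γ * u / 4)))
          ≤ 4 / γ * (u + 4 / γ) * (1 + 4 / (γ / 4) ^ 2) := by
        have := mul_le_mul_of_nonneg_left hsq_exp (show 0 ≤ 4 / γ * (u + 4 / γ) by positivity)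
        calc (1 + u) ^ 2 * (4 / γ * (u + 4 / γ) * Real.exp (-(γ * u / 4)))
            = 4 / γ * (u + 4 / γ) * ((1 + u) ^ 2 * Real.exp (-(γ * u / 4))) := by ring
          _ ≤ 4 / γ * (u + 4 / γ) * (1 + 4 / (γ / 4) ^ 2) := this
      -- F2: D·(1+u)²·Q = (4/γ)(u+4/γ)(16G₀M/γ)
      have F2 : (1 + u) ^ 2 * (4 / γ * (u + 4 / γ) * Real.exp (-(γ * u / 4))) * Q
          = 4 / γ * (u + 4 / γ) * (16 * G₀ * M / γ) := by
        have h1u2 : (1 + u) ^ 2 ≠ 0 := by positivity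
        rw [hQ]
        calc (1 + u) ^ 2 * (4 / γ * (u + 4 / γ) * Real.exp (-(γ * u / 4))) * (16 * G₀ * M / γ * (E u / (1 + u) ^ 2))
            = 4 / γ * (u + 4 / γ) * (16 * G₀ * M / γ) * (Real.exp (-(γ * u / 4)) * E u)
                * ((1 + u) ^ 2 / (1 + u) ^ 2) := by ring
          _ = 4 / γ * (u + 4 / γ) * (16 * G₀ * M / γ) := by rw [hEinv u, div_self h1u2]; ring
      calc (1 + u) ^ 2 * (4 / γ * (u + 4 / γ) * Real.exp (-(γ * u / 4))) * |H u|
          ≤ (1 + u) ^ 2 * (4 / γ * (u + 4 / γ) * Real.exp (-(γ * u / 4))) * (P + Q) := by gcongr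
        _ = (1 + u) ^ 2 * (4 / γ * (u + 4 / γ) * Real.exp (-(γ * u / 4))) * P
              + (1 + u) ^ 2 * (4 / γ * (u + 4 / γ) * Real.exp (-(γ * u / 4))) * Q := by ring
        _ ≤ 4 / γ * (u + 4 / γ) * (1 + 4 / (γ / 4) ^ 2) * P + 4 / γ * (u + 4 / γ) * (16 * G₀ * M / γ) := by
            rw [F2]
            have := mul_le_mul_of_nonneg_right F1 hPnn
            linarith only [this]
        _ = (u + 4 / γ) * (4 / γ * ((1 + 4 / (γ / 4) ^ 2) * P + 16 * G₀ * M / γ)) := by ring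
        _ ≤ ((1 + 4 / γ) * u) * (4 / γ * ((1 + 4 / (γ / 4) ^ 2) * P + 16 * G₀ * M / γ)) := by
            apply mul_le_mul_of_nonneg_right hratio
            positivity
        _ = 4 * u * T₂ * M := by rw [hT₂, hP, hEs₁]; ring
        _ ≤ 4 * u * (T₁ + T₂) * M := by
            have : 4 * u * T₂ ≤ 4 * u * (T₁ + T₂) := by nlinarith only [hT₁pos, hupos]
            exact mul_le_mul_of_nonneg_right this hM
  -- TermB: (1+u)² (g/gU)|J u| ≤ 4u T₃ M / gU
  have hTermB : (1 + u) ^ 2 * ((g u / g U) * |J u|) ≤ 4 * u * (T₃ * M / g U) := by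
    have hJ1 := hJbound u hupos huU
    -- the bracket times (1+u)²:  (1+u)²(1/(1+u) + (4/γ)/(u(1+u))) = (1+u)(u + 4/γ)/u
    have hbr : (1 + u) ^ 2 * (1 / (1 + u) + 4 / γ * (1 / (u * (1 + u)))) = (1 + u) * (u + 4 / γ) / u := by
      field_simp
    have hstep : (1 + u) ^ 2 * ((g u / g U) * |J u|)
        ≤ (g u / g U) * (4 * M / γ) * ((1 + u) * (u + 4 / γ) / u) := by
      have := mul_le_mul_of_nonneg_left hJ1 hcoef₂
      have := mul_le_mul_of_nonneg_left this (sq_nonneg (1 + u))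
      calc (1 + u) ^ 2 * ((g u / g U) * |J u|)
          ≤ (1 + u) ^ 2 * ((g u / g U) * (4 * M / γ * (1 / (1 + u) + 4 / γ * (1 / (u * (1 + u)))))) := this
        _ = (g u / g U) * (4 * M / γ) * ((1 + u) ^ 2 * (1 / (1 + u) + 4 / γ * (1 / (u * (1 + u))))) := by ring
        _ = (g u / g U) * (4 * M / γ) * ((1 + u) * (u + 4 / γ) / u) := by rw [hbr]
    refine hstep.trans ?_
    -- key: g u (1+u)(u+4/γ) ≤ γ T₃ u² = 2(1+4/γ)(1+16/γ²) u²
    have hkey : g u * ((1 + u) * (u + 4 / γ)) ≤ 2 * (1 + 4 / γ) * (1 + 16 / γ ^ 2) * u ^ 2 := by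
      rcases le_or_gt u 1 with hu1 | h1u'
      · have hsq : g u ≤ u ^ 2 := hg_sq u hupos.le
        have h1 : (1 + u) * (u + 4 / γ) ≤ 2 * (1 + 4 / γ) :=
          mul_le_mul (by linarith only [hu1]) (by linarith only [hu1]) (by positivity) (by positivity)
        have hu2 : u ^ 2 * (2 * (1 + 4 / γ)) ≤ 2 * (1 + 4 / γ) * (1 + 16 / γ ^ 2) * u ^ 2 := by
          have hle1 : 2 * (1 + 4 / γ) ≤ 2 * (1 + 4 / γ) * (1 + 16 / γ ^ 2) :=
            le_mul_of_one_le_right (by positivity) (by linarith only [h16])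
          have := mul_le_mul_of_nonneg_left hle1 (sq_nonneg u)
          linarith only [this]
        calc g u * ((1 + u) * (u + 4 / γ)) ≤ u ^ 2 * (2 * (1 + 4 / γ)) :=
              mul_le_mul hsq h1 (by positivity) (by positivity)
          _ ≤ 2 * (1 + 4 / γ) * (1 + 16 / γ ^ 2) * u ^ 2 := hu2
      · have hsup : g u ≤ 16 / γ ^ 2 := hg_sup u hupos.le
        have hu1 : 1 ≤ u := h1u'.le
        have ha : 1 + u ≤ 2 * u := by linarith only [hu1]
        have hb : u + 4 / γ ≤ (1 + 4 / γ) * u := by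
          have := le_mul_of_one_le_right h4γ hu1
          linarith only [this]
        have h1 : (1 + u) * (u + 4 / γ) ≤ (2 * u) * ((1 + 4 / γ) * u) :=
          mul_le_mul ha hb (by positivity) (by positivity)
        have h2 : 16 / γ ^ 2 ≤ 1 + 16 / γ ^ 2 := by linarith only [h16]
        calc g u * ((1 + u) * (u + 4 / γ)) ≤ (1 + 16 / γ ^ 2) * ((2 * u) * ((1 + 4 / γ) * u)) :=
              mul_le_mul (hsup.trans h2) h1 (by positivity) (by positivity)
          _ = 2 * (1 + 4 / γ) * (1 + 16 / γ ^ 2) * u ^ 2 := by ring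
    have hT₃' : 2 * (1 + 4 / γ) * (1 + 16 / γ ^ 2) = γ * T₃ := by rw [hT₃]; field_simp
    calc (g u / g U) * (4 * M / γ) * ((1 + u) * (u + 4 / γ) / u)
        = (4 * M / γ) / g U / u * (g u * ((1 + u) * (u + 4 / γ))) := by
          field_simp
      _ ≤ (4 * M / γ) / g U / u * (2 * (1 + 4 / γ) * (1 + 16 / γ ^ 2) * u ^ 2) :=
          mul_le_mul_of_nonneg_left hkey (by positivity)
      _ = 4 * u * (T₃ * M / g U) := by
          rw [hT₃']
          field_simp
  -- conclusion
  have hsum : (1 + u) ^ 2 * (4 * u ^ 2 * |v u|) ≤ 4 * u * ((T₁ + T₂ + T₃) * M / g U) := by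
    calc (1 + u) ^ 2 * (4 * u ^ 2 * |v u|) ≤ (1 + u) ^ 2 * ((1 - g u / g U) * |H u| + (g u / g U) * |J u|) := by
          gcongr
      _ = (1 + u) ^ 2 * ((1 - g u / g U) * |H u|) + (1 + u) ^ 2 * ((g u / g U) * |J u|) := by ring
      _ ≤ 4 * u * ((T₁ + T₂) * M / g U) + 4 * u * (T₃ * M / g U) := add_le_add hTermA hTermB
      _ = 4 * u * ((T₁ + T₂ + T₃) * M / g U) := by ring
  have hfin : (1 + u) ^ 2 * (u * |v u|) ≤ (T₁ + T₂ + T₃) * M / g U := by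
    have h4u : 0 < 4 * u := by positivity
    have := hsum
    rw [show (1 + u) ^ 2 * (4 * u ^ 2 * |v u|) = 4 * u * ((1 + u) ^ 2 * (u * |v u|)) by ring] at this
    exact le_of_mul_le_mul_left this h4u
  calc (1 + u) ^ 2 * (u * |v u|) ≤ (T₁ + T₂ + T₃) * M / g U := hfin
    _ ≤ (T₁ + T₂ + T₃) * M / gl := by
        apply div_le_div_of_nonneg_left (by positivity) hglpos hgU
    _ = (T₁ + T₂ + T₃) / gl * M := by ring
    _ ≤ ((T₁ + T₂ + T₃) / gl + 1) * M := by
        have h := mul_le_mul_of_nonneg_right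
          (le_add_of_nonneg_right zero_le_one : (T₁ + T₂ + T₃) / gl ≤ (T₁ + T₂ + T₃) / gl + 1) hM
        linarith only [h]


end Summit.NavierStokesRegularity.NavierStokesRegularity.Theorems.DefectColumnGate

end
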